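import Summits.CriticalPhenomena.PercolationContinuityZ3.Theorems.PercNearOneGluingNoHeavyLowerTailSahiOneStepThresholdTwo
import HarnessLib

/-!
# One-step scheme: FREE-COORDINATE EXTENSION of the two hypotheses (tower-free), and Q-HARRIS for the threshold-two family
# against ARBITRARY increasing events

Support file (prover prim-ineq-prove-3 gen 15; `--supports stmt-CriticalPhenomena-4575`; memo
`run/shared/lean/prim/prim-ineq-prove-3/FINDING-G15-TH2-KERNEL.md` §5).  No definitions, no named facts, no sorries, no `native_decide`.

Setting (`…SahiOneStepCone`): `μ = prodBernoulli p`, first slot `H`, `m′ = osMp p H (ind A) (ind B)`, `n = osN p H (ind A) (ind B)`.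
For a coordinate `e` on which `H` does NOT depend, write `X¹ = {ω | insert e ω ∈ X}`, `X⁰ = {ω | ω ∖ {e} ∈ X}` for the two sections.
* `osMp_ind_ind_free_split` — PIVOT IDENTITY along an `H`-free coordinate:
  `m′(A,B) = p_e·m′(A¹,B¹) + q_e·m′(A⁰,B⁰) + p_e q_e·(μ(HA¹) − μ(HA⁰))(μ(HB¹) − μ(HB⁰))` — the last term is `≥ 0` for increasing `A, B`;
* `osN_ind_ind_free_split` — `n(A,B) = p²·n(A¹,B¹) + q²·n(A⁰,B⁰) + pq·(n(A¹,B⁰) + n(A⁰,B¹)) + (1 − μH)·pq·μ(H ∩ (A¹∖A⁰) ∩ (B¹∖B⁰))`;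
* `osMp_osN_nonneg_of_determined` — hence (induction on the extra coordinates): if `H` is determined by `F` and `m′, n ≥ 0` on all pairs of increasing
  events DETERMINED BY `F`, then `m′, n ≥ 0` on ALL pairs of increasing events of `2^ι`.  (This re-proves `sahiE3_nonneg_of_ind` without the antithetic
  tower, since `E₃ = m′ + n` on indicators; that corollary is not restated here.)
* **`osMp_nonneg_orEvent_union_thresholdTwo`, `osN_nonneg_orEvent_union_thresholdTwo`** — with `…SahiOneStepThresholdTwo`: for EVERY slot
  `H = orEvent J ∪ Th₂(F)` (any finsets `J, F`; `F = ∅`: OR slot, `J = ∅`: threshold-two slot) and ALL increasing `A, B ⊆ 2^ι`: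
  `(1 + μH)·μ(H∩A∩B) ≥ μ(H)·μ(A∩B) + μ(H∩A)·μ(H∩B)` (the quantitative Harris inequality "Q-HARRIS" of the memo, conjectured for every increasing `H`)
  and `Cov(A,B) ≥ μ(Hᶜ)·Cov(A,B ∣ Hᶜ)`.
-/

noncomputable section

namespace Summit.CriticalPhenomena.PercolationContinuityZ3.Theorems

namespace SahiOneStep

open MeasureTheory
open Literature.Probability.Percolation (DeterminedBy determinedBy_iff determinedBy_univ)
open Literature.Probability.LatticeModels (prodBernoulli sahiE3)
open Literature.Probability.Percolation.DecisionTree (ind)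
open SahiCdd (orEvent)
open SahiE3Sections (real_inter_section_split determinedBy_section_insert determinedBy_section_sdiff)
open scoped Classical

variable {ι : Type*} [Fintype ι]

/-! ## Sections at one coordinate -/

omit [Fintype ι] in
/-- The inner section of an increasing event is increasing. [folklore] -/
theorem isUpperSet_section_insert {X : Set (Set ι)} (hX : IsUpperSet X) (e : ι) : IsUpperSet {ω : Set ι | insert e ω ∈ X} :=
  fun _ _ hle hω => hX (Set.insert_subset_insert hle) hω

omit [Fintype ι] in
/-- The outer section of an increasing event is increasing. [folklore] -/
theorem isUpperSet_section_sdiff {X : Set (Set ι)} (hX : IsUpperSet X) (e : ι) : IsUpperSet {ω : Set ι | ω \ {e} ∈ X} :=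
  fun _ _ hle hω => hX (Set.sdiff_subset_sdiff_left hle) hω

omit [Fintype ι] in
/-- For an increasing event the outer section lies inside the inner one (`ω ∖ {e} ⊆ insert e ω`). [folklore] -/
theorem section_sdiff_subset_section_insert {X : Set (Set ι)} (hX : IsUpperSet X) (e : ι) :
    {ω : Set ι | ω \ {e} ∈ X} ⊆ {ω : Set ι | insert e ω ∈ X} :=
  fun _ hω => hX (Set.sdiff_subset.trans (Set.subset_insert _ _)) hω

omit [Fintype ι] in
/-- Sections commute with intersections (inner). [folklore] -/
theorem section_insert_inter (X Y : Set (Set ι)) (e : ι) :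
    {ω : Set ι | insert e ω ∈ X ∩ Y} = {ω : Set ι | insert e ω ∈ X} ∩ {ω : Set ι | insert e ω ∈ Y} := by
  ext ω; simp only [Set.mem_setOf_eq, Set.mem_inter_iff]

omit [Fintype ι] in
/-- Sections commute with intersections (outer). [folklore] -/
theorem section_sdiff_inter (X Y : Set (Set ι)) (e : ι) :
    {ω : Set ι | ω \ {e} ∈ X ∩ Y} = {ω : Set ι | ω \ {e} ∈ X} ∩ {ω : Set ι | ω \ {e} ∈ Y} := by
  ext ω; simp only [Set.mem_setOf_eq, Set.mem_inter_iff]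

/-- Splitting `μ(H ∩ X)` along a coordinate `e` free for `H`. [folklore] -/
theorem real_inter_split_free (p : ι → unitInterval) {H : Set (Set ι)} (e : ι)
    (hH : DeterminedBy H ((({e} : Finset ι) : Set ι)ᶜ)) (X : Set (Set ι)) :
    (prodBernoulli p).real (H ∩ X) =
      (p e : ℝ) * (prodBernoulli p).real (H ∩ {ω : Set ι | insert e ω ∈ X}) +
        (1 - p e) * (prodBernoulli p).real (H ∩ {ω : Set ι | ω \ {e} ∈ X}) :=
  real_inter_section_split p e hH X

/-- Splitting `μ(X)` along any coordinate `e`. [folklore] -/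
theorem real_split (p : ι → unitInterval) (e : ι) (X : Set (Set ι)) :
    (prodBernoulli p).real X =
      (p e : ℝ) * (prodBernoulli p).real {ω : Set ι | insert e ω ∈ X} +
        (1 - p e) * (prodBernoulli p).real {ω : Set ι | ω \ {e} ∈ X} := by
  have h := real_inter_section_split p e (determinedBy_univ _) X
  simp only [Set.univ_inter] at h
  exact h

/-! ## The two splitting identities along an `H`-free coordinate -/

/-- **Pivot identity for `m′` along an `H`-free coordinate `e`:**
`m′(A,B) = p_e·m′(A¹,B¹) + (1−p_e)·m′(A⁰,B⁰) + p_e(1−p_e)·(μ(H∩A¹) − μ(H∩A⁰))·(μ(H∩B¹) − μ(H∩B⁰))`. [this work] -/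
theorem osMp_ind_ind_free_split (p : ι → unitInterval) {H : Set (Set ι)} (e : ι)
    (hH : DeterminedBy H ((({e} : Finset ι) : Set ι)ᶜ)) (A B : Set (Set ι)) :
    osMp p H (ind A) (ind B) =
      (p e : ℝ) * osMp p H (ind {ω : Set ι | insert e ω ∈ A}) (ind {ω : Set ι | insert e ω ∈ B})
        + (1 - p e) * osMp p H (ind {ω : Set ι | ω \ {e} ∈ A}) (ind {ω : Set ι | ω \ {e} ∈ B})
        + (p e : ℝ) * (1 - p e) *
          (((prodBernoulli p).real (H ∩ {ω : Set ι | insert e ω ∈ A}) - (prodBernoulli p).real (H ∩ {ω : Set ι | ω \ {e} ∈ A})) *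
            ((prodBernoulli p).real (H ∩ {ω : Set ι | insert e ω ∈ B}) - (prodBernoulli p).real (H ∩ {ω : Set ι | ω \ {e} ∈ B}))) := by
  have e1 : (prodBernoulli p).real (H ∩ A ∩ B) =
      (p e : ℝ) * (prodBernoulli p).real (H ∩ {ω : Set ι | insert e ω ∈ A} ∩ {ω : Set ι | insert e ω ∈ B}) +
        (1 - p e) * (prodBernoulli p).real (H ∩ {ω : Set ι | ω \ {e} ∈ A} ∩ {ω : Set ι | ω \ {e} ∈ B}) := by
    rw [Set.inter_assoc, real_inter_split_free p e hH (A ∩ B), section_insert_inter, section_sdiff_inter, ← Set.inter_assoc,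
      ← Set.inter_assoc]
  have e2 := real_inter_split_free p e hH A
  have e3 := real_inter_split_free p e hH B
  have e4 : (prodBernoulli p).real (A ∩ B) =
      (p e : ℝ) * (prodBernoulli p).real ({ω : Set ι | insert e ω ∈ A} ∩ {ω : Set ι | insert e ω ∈ B}) +
        (1 - p e) * (prodBernoulli p).real ({ω : Set ι | ω \ {e} ∈ A} ∩ {ω : Set ι | ω \ {e} ∈ B}) := by
    rw [real_split p e (A ∩ B), section_insert_inter, section_sdiff_inter]
  rw [osMp_ind_ind, osMp_ind_ind, osMp_ind_ind, e1, e2, e3, e4]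
  ring

/-- **Splitting identity for `n` along an `H`-free coordinate `e`** (for increasing `A, B`):
`n(A,B) = p²·n(A¹,B¹) + q²·n(A⁰,B⁰) + pq·(n(A¹,B⁰) + n(A⁰,B¹)) + (1 − μH)·pq·μ(H ∩ (A¹∖A⁰) ∩ (B¹∖B⁰))`. [this work] -/
theorem osN_ind_ind_free_split (p : ι → unitInterval) {H : Set (Set ι)} (e : ι)
    (hH : DeterminedBy H ((({e} : Finset ι) : Set ι)ᶜ)) {A B : Set (Set ι)} (hA : IsUpperSet A) (hB : IsUpperSet B) :
    osN p H (ind A) (ind B) =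
      (p e : ℝ) ^ 2 * osN p H (ind {ω : Set ι | insert e ω ∈ A}) (ind {ω : Set ι | insert e ω ∈ B})
        + (1 - p e) ^ 2 * osN p H (ind {ω : Set ι | ω \ {e} ∈ A}) (ind {ω : Set ι | ω \ {e} ∈ B})
        + (p e : ℝ) * (1 - p e) *
          (osN p H (ind {ω : Set ι | insert e ω ∈ A}) (ind {ω : Set ι | ω \ {e} ∈ B})
            + osN p H (ind {ω : Set ι | ω \ {e} ∈ A}) (ind {ω : Set ι | insert e ω ∈ B}))
        + (1 - (prodBernoulli p).real H) * ((p e : ℝ) * (1 - p e)) *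
          (prodBernoulli p).real (H ∩ ({ω : Set ι | insert e ω ∈ A} \ {ω : Set ι | ω \ {e} ∈ A}) ∩
            ({ω : Set ι | insert e ω ∈ B} \ {ω : Set ι | ω \ {e} ∈ B})) := by
  set μ := prodBernoulli p with hμ
  set A1 : Set (Set ι) := {ω : Set ι | insert e ω ∈ A} with hA1
  set A0 : Set (Set ι) := {ω : Set ι | ω \ {e} ∈ A} with hA0
  set B1 : Set (Set ι) := {ω : Set ι | insert e ω ∈ B} with hB1
  set B0 : Set (Set ι) := {ω : Set ι | ω \ {e} ∈ B} with hB0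
  have hA01 : A0 ⊆ A1 := section_sdiff_subset_section_insert hA e
  have hB01 : B0 ⊆ B1 := section_sdiff_subset_section_insert hB e
  have e1 : μ.real (H ∩ A ∩ B) = (p e : ℝ) * μ.real (H ∩ A1 ∩ B1) + (1 - p e) * μ.real (H ∩ A0 ∩ B0) := by
    rw [Set.inter_assoc, real_inter_split_free p e hH (A ∩ B), section_insert_inter, section_sdiff_inter, ← Set.inter_assoc,
      ← Set.inter_assoc]
  have e2 : μ.real (H ∩ A) = (p e : ℝ) * μ.real (H ∩ A1) + (1 - p e) * μ.real (H ∩ A0) := real_inter_split_free p e hH A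
  have e3 : μ.real (H ∩ B) = (p e : ℝ) * μ.real (H ∩ B1) + (1 - p e) * μ.real (H ∩ B0) := real_inter_split_free p e hH B
  have e4 : μ.real A = (p e : ℝ) * μ.real A1 + (1 - p e) * μ.real A0 := real_split p e A
  have e5 : μ.real B = (p e : ℝ) * μ.real B1 + (1 - p e) * μ.real B0 := real_split p e B
  -- inclusion–exclusion for the difference sets (nested sections)
  have e6 : μ.real (H ∩ (A1 \ A0) ∩ (B1 \ B0)) =
      μ.real (H ∩ A1 ∩ B1) - μ.real (H ∩ A1 ∩ B0) - μ.real (H ∩ A0 ∩ B1) + μ.real (H ∩ A0 ∩ B0) := by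
    have s1 : H ∩ (A1 \ A0) ∩ (B1 \ B0) = (H ∩ A1 ∩ (B1 \ B0)) \ (H ∩ A0 ∩ (B1 \ B0)) := by
      ext ω; simp only [Set.mem_inter_iff, Set.mem_sdiff]; tauto
    have s1' : H ∩ A0 ∩ (B1 \ B0) ⊆ H ∩ A1 ∩ (B1 \ B0) := fun ω hω => ⟨⟨hω.1.1, hA01 hω.1.2⟩, hω.2⟩
    have s2 : ∀ C : Set (Set ι), H ∩ C ∩ (B1 \ B0) = (H ∩ C ∩ B1) \ (H ∩ C ∩ B0) := fun C => by
      ext ω; simp only [Set.mem_inter_iff, Set.mem_sdiff]; tauto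
    have s2' : ∀ C : Set (Set ι), H ∩ C ∩ B0 ⊆ H ∩ C ∩ B1 := fun C ω hω => ⟨hω.1, hB01 hω.2⟩
    rw [s1, measureReal_sdiff s1' MeasurableSet.of_discrete, s2 A1, s2 A0, measureReal_sdiff (s2' A1) MeasurableSet.of_discrete,
      measureReal_sdiff (s2' A0) MeasurableSet.of_discrete]
    ring
  rw [osN_ind_ind, osN_ind_ind, osN_ind_ind, osN_ind_ind, osN_ind_ind, e1, e2, e3, e4, e5, e6]
  ring

/-! ## Propagation: hypotheses on `F`-determined pairs give all pairs -/

/-- **FREE-COORDINATE EXTENSION (tower-free form of the one-step scheme).**  If `H` is determined by `F` and `m′, n ≥ 0` on all pairs of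
increasing events determined by `F`, then `m′ ≥ 0` and `n ≥ 0` on ALL pairs of increasing events. [this work] -/
theorem osMp_osN_nonneg_of_determined (p : ι → unitInterval) {H : Set (Set ι)} {F : Finset ι} (hH : DeterminedBy H (F : Set ι))
    (h3 : ∀ A B : Set (Set ι), IsUpperSet A → IsUpperSet B → DeterminedBy A (F : Set ι) → DeterminedBy B (F : Set ι) →
      0 ≤ osMp p H (ind A) (ind B))
    (h2 : ∀ A B : Set (Set ι), IsUpperSet A → IsUpperSet B → DeterminedBy A (F : Set ι) → DeterminedBy B (F : Set ι) →
      0 ≤ osN p H (ind A) (ind B))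
    {A B : Set (Set ι)} (hA : IsUpperSet A) (hB : IsUpperSet B) :
    0 ≤ osMp p H (ind A) (ind B) ∧ 0 ≤ osN p H (ind A) (ind B) := by
  -- induction on a finset `G` of extra coordinates: pairs determined by `F ∪ G`
  suffices key : ∀ G : Finset ι, ∀ A B : Set (Set ι), IsUpperSet A → IsUpperSet B →
      DeterminedBy A (((F ∪ G : Finset ι)) : Set ι) → DeterminedBy B (((F ∪ G : Finset ι)) : Set ι) →
      0 ≤ osMp p H (ind A) (ind B) ∧ 0 ≤ osN p H (ind A) (ind B) by
    have hsub : (Set.univ : Set ι) ⊆ (((F ∪ Finset.univ : Finset ι)) : Set ι) := fun i _ => by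
      simp only [Finset.coe_union, Finset.coe_univ, Set.mem_union, Set.mem_univ, or_true]
    have hAu : DeterminedBy A (((F ∪ Finset.univ : Finset ι)) : Set ι) := (SahiE3Sections.determinedBy_univ_set A).mono hsub
    have hBu : DeterminedBy B (((F ∪ Finset.univ : Finset ι)) : Set ι) := (SahiE3Sections.determinedBy_univ_set B).mono hsub
    exact key Finset.univ A B hA hB hAu hBu
  intro G
  induction G using Finset.induction_on with
  | empty =>
    intro A B hA hB hAF hBF
    rw [Finset.union_empty] at hAF hBF
    exact ⟨h3 A B hA hB hAF hBF, h2 A B hA hB hAF hBF⟩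
  | insert e G heG ih =>
    intro A B hA hB hAF hBF
    by_cases he : e ∈ F
    · have hFG : F ∪ insert e G = F ∪ G := by
        ext i; simp only [Finset.mem_union, Finset.mem_insert]
        constructor
        · rintro (h | rfl | h)
          · exact Or.inl h
          · exact Or.inl he
          · exact Or.inr h
        · rintro (h | h)
          · exact Or.inl h
          · exact Or.inr (Or.inr h)
      rw [hFG] at hAF hBF
      exact ih A B hA hB hAF hBF
    · -- `e` is free for `H`
      have hHe : DeterminedBy H ((({e} : Finset ι) : Set ι)ᶜ) :=
        hH.mono fun i hi hie => he (by rw [Finset.coe_singleton, Set.mem_singleton_iff] at hie; rw [← hie]; exact hi)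
      -- sections are determined by `F ∪ G`
      have hsub : (((F ∪ insert e G : Finset ι)) : Set ι) \ {e} ⊆ (((F ∪ G : Finset ι)) : Set ι) := by
        intro i hi
        simp only [Set.mem_sdiff, Finset.mem_coe, Finset.mem_union, Finset.mem_insert, Set.mem_singleton_iff] at hi
        simp only [Finset.coe_union, Set.mem_union, Finset.mem_coe]
        rcases hi with ⟨h | rfl | h, hne⟩
        · exact Or.inl h
        · exact absurd rfl hne
        · exact Or.inr h
      have hA1 : DeterminedBy {ω : Set ι | insert e ω ∈ A} (((F ∪ G : Finset ι)) : Set ι) :=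
        (determinedBy_section_insert hAF e).mono hsub
      have hA0 : DeterminedBy {ω : Set ι | ω \ {e} ∈ A} (((F ∪ G : Finset ι)) : Set ι) :=
        (determinedBy_section_sdiff hAF e).mono hsub
      have hB1 : DeterminedBy {ω : Set ι | insert e ω ∈ B} (((F ∪ G : Finset ι)) : Set ι) :=
        (determinedBy_section_insert hBF e).mono hsub
      have hB0 : DeterminedBy {ω : Set ι | ω \ {e} ∈ B} (((F ∪ G : Finset ι)) : Set ι) :=
        (determinedBy_section_sdiff hBF e).mono hsub
      have uA1 := isUpperSet_section_insert hA e
      have uA0 := isUpperSet_section_sdiff hA e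
      have uB1 := isUpperSet_section_insert hB e
      have uB0 := isUpperSet_section_sdiff hB e
      obtain ⟨m11, n11⟩ := ih _ _ uA1 uB1 hA1 hB1
      obtain ⟨m00, n00⟩ := ih _ _ uA0 uB0 hA0 hB0
      obtain ⟨-, n10⟩ := ih _ _ uA1 uB0 hA1 hB0
      obtain ⟨-, n01⟩ := ih _ _ uA0 uB1 hA0 hB1
      have hp0 : 0 ≤ (p e : ℝ) := (p e).2.1
      have hp1 : (p e : ℝ) ≤ 1 := (p e).2.2
      have hq0 : 0 ≤ 1 - (p e : ℝ) := sub_nonneg.2 hp1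
      constructor
      · rw [osMp_ind_ind_free_split p e hHe A B]
        have dA : 0 ≤ (prodBernoulli p).real (H ∩ {ω : Set ι | insert e ω ∈ A}) -
            (prodBernoulli p).real (H ∩ {ω : Set ι | ω \ {e} ∈ A}) :=
          sub_nonneg.2 (measureReal_mono (Set.inter_subset_inter_right _ (section_sdiff_subset_section_insert hA e)))
        have dB : 0 ≤ (prodBernoulli p).real (H ∩ {ω : Set ι | insert e ω ∈ B}) -
            (prodBernoulli p).real (H ∩ {ω : Set ι | ω \ {e} ∈ B}) :=
          sub_nonneg.2 (measureReal_mono (Set.inter_subset_inter_right _ (section_sdiff_subset_section_insert hB e)))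
        have t1 := mul_nonneg hp0 m11
        have t2 := mul_nonneg hq0 m00
        have t3 := mul_nonneg (mul_nonneg hp0 hq0) (mul_nonneg dA dB)
        linarith
      · rw [osN_ind_ind_free_split p e hHe hA hB]
        have hc : 0 ≤ 1 - (prodBernoulli p).real H := sub_nonneg.2 measureReal_le_one
        have t1 := mul_nonneg (pow_nonneg hp0 2) n11
        have t2 := mul_nonneg (pow_nonneg hq0 2) n00
        have t3 := mul_nonneg (mul_nonneg hp0 hq0) (add_nonneg n10 n01)
        have t4 := mul_nonneg (mul_nonneg hc (mul_nonneg hp0 hq0))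
          (measureReal_nonneg (μ := prodBernoulli p)
            (s := H ∩ ({ω : Set ι | insert e ω ∈ A} \ {ω : Set ι | ω \ {e} ∈ A}) ∩
              ({ω : Set ι | insert e ω ∈ B} \ {ω : Set ι | ω \ {e} ∈ B})))
        linarith

/-! ## Q-HARRIS and (2′) for the threshold-two family against arbitrary increasing events -/

/-- **Q-HARRIS for every slot `H ⊇ Th₂(F)` determined by `F`, against ALL increasing `A, B`:**
`(1 + μH)μ(H∩A∩B) − μ(H)μ(A∩B) − μ(H∩A)μ(H∩B) ≥ 0`, i.e. `Cov(1_{H∩A},1_{H∩B}) ≥ μ(H)·μ(A∩B∖H)`. [this work] -/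
theorem osMp_nonneg_of_thresholdTwo_subset_all (p : ι → unitInterval) (F : Finset ι) {H : Set (Set ι)} (hH : IsUpperSet H)
    (hHF : DeterminedBy H (F : Set ι)) (hH2 : {ω : Set ι | ∃ i ∈ F, ∃ j ∈ F, i ≠ j ∧ i ∈ ω ∧ j ∈ ω} ⊆ H)
    {A B : Set (Set ι)} (hA : IsUpperSet A) (hB : IsUpperSet B) :
    0 ≤ osMp p H (ind A) (ind B) :=
  (osMp_osN_nonneg_of_determined p hHF
    (fun _ _ hA' hB' hAF hBF => osMp_ind_ind_nonneg_of_thresholdTwo_subset p F hH hH2 hA' hB' hAF hBF)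
    (fun _ _ hA' hB' hAF hBF => osN_ind_ind_nonneg_of_thresholdTwo_subset p F hH hH2 hA' hB' hAF hBF) hA hB).1

/-- **(2′) for every slot `H ⊇ Th₂(F)` determined by `F`, against ALL increasing `A, B`:** `Cov(A,B) ≥ μ(Hᶜ)·Cov(A,B ∣ Hᶜ)` in the
polynomial form `μ(HA)μ(HB) + μ(Hᶜ)μ(HAB) + μ(H)μ(A)μ(B) − μ(HA)μ(B) − μ(HB)μ(A) ≥ 0`. [this work] -/
theorem osN_nonneg_of_thresholdTwo_subset_all (p : ι → unitInterval) (F : Finset ι) {H : Set (Set ι)} (hH : IsUpperSet H)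
    (hHF : DeterminedBy H (F : Set ι)) (hH2 : {ω : Set ι | ∃ i ∈ F, ∃ j ∈ F, i ≠ j ∧ i ∈ ω ∧ j ∈ ω} ⊆ H)
    {A B : Set (Set ι)} (hA : IsUpperSet A) (hB : IsUpperSet B) :
    0 ≤ osN p H (ind A) (ind B) :=
  (osMp_osN_nonneg_of_determined p hHF
    (fun _ _ hA' hB' hAF hBF => osMp_ind_ind_nonneg_of_thresholdTwo_subset p F hH hH2 hA' hB' hAF hBF)
    (fun _ _ hA' hB' hAF hBF => osN_ind_ind_nonneg_of_thresholdTwo_subset p F hH hH2 hA' hB' hAF hBF) hA hB).2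

/-- **Q-HARRIS for the slot "a coordinate of `J`, or two of `F`"** (`H = orEvent J ∪ Th₂(F)`, any finsets `J, F`), measure form: for ALL increasing
`A, B ⊆ 2^ι`, `(1 + μH)·μ(H ∩ A ∩ B) ≥ μ(H)·μ(A ∩ B) + μ(H ∩ A)·μ(H ∩ B)`. [this work] -/
theorem qharris_orEvent_union_thresholdTwo (p : ι → unitInterval) (J F : Finset ι) {A B : Set (Set ι)}
    (hA : IsUpperSet A) (hB : IsUpperSet B) :
    (prodBernoulli p).real ((orEvent J : Set (Set ι)) ∪ {ω : Set ι | ∃ i ∈ F, ∃ j ∈ F, i ≠ j ∧ i ∈ ω ∧ j ∈ ω}) *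
          (prodBernoulli p).real (A ∩ B) +
        (prodBernoulli p).real (((orEvent J : Set (Set ι)) ∪ {ω : Set ι | ∃ i ∈ F, ∃ j ∈ F, i ≠ j ∧ i ∈ ω ∧ j ∈ ω}) ∩ A) *
          (prodBernoulli p).real (((orEvent J : Set (Set ι)) ∪ {ω : Set ι | ∃ i ∈ F, ∃ j ∈ F, i ≠ j ∧ i ∈ ω ∧ j ∈ ω}) ∩ B) ≤
      (1 + (prodBernoulli p).real ((orEvent J : Set (Set ι)) ∪ {ω : Set ι | ∃ i ∈ F, ∃ j ∈ F, i ≠ j ∧ i ∈ ω ∧ j ∈ ω})) *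
        (prodBernoulli p).real (((orEvent J : Set (Set ι)) ∪ {ω : Set ι | ∃ i ∈ F, ∃ j ∈ F, i ≠ j ∧ i ∈ ω ∧ j ∈ ω}) ∩ A ∩ B) := by
  set H : Set (Set ι) := (orEvent J : Set (Set ι)) ∪ {ω : Set ι | ∃ i ∈ F, ∃ j ∈ F, i ≠ j ∧ i ∈ ω ∧ j ∈ ω} with hHdef
  have hH : IsUpperSet H := (isUpperSet_orEvent J).union (isUpperSet_thresholdTwo F)
  have h1 : DeterminedBy (orEvent J : Set (Set ι)) (↑(J ∪ F) : Set ι) :=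
    (determinedBy_orEvent J).mono (by rw [Finset.coe_union]; exact Set.subset_union_left)
  have h2 : DeterminedBy {ω : Set ι | ∃ i ∈ F, ∃ j ∈ F, i ≠ j ∧ i ∈ ω ∧ j ∈ ω} (↑(J ∪ F) : Set ι) :=
    (determinedBy_thresholdTwo F).mono (by rw [Finset.coe_union]; exact Set.subset_union_right)
  have hHF : DeterminedBy H (↑(J ∪ F) : Set ι) := by
    rw [determinedBy_iff] at h1 h2 ⊢
    intro ω ω' h
    rw [hHdef, Set.mem_union, Set.mem_union, h1 ω ω' h, h2 ω ω' h]
  have key := osMp_nonneg_of_thresholdTwo_subset_all p (J ∪ F) hH hHF (thresholdTwo_union_subset J F) hA hB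
  rw [osMp_ind_ind] at key
  linarith

end SahiOneStep

end Summit.CriticalPhenomena.PercolationContinuityZ3.Theorems
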